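import Summits.HubbardSuperconductivity.HubbardLadder.PairCorrParticleHoleSectors
import Summits.HubbardSuperconductivity.HubbardSuperconductivity.Theorems.SoloBlindParticleHoleSymmetry
import Summits.HubbardSuperconductivity.HubbardLadder.R3R4Props
import HarnessLib

/-!
# Particle–hole dictionary of the pair channel on the `t–t'` torus

HONEST FRAMING: ladder R1–R4 with certified numbers; no claim on H/H₀. This file is part 2 of the
exact SYMMETRY DICTIONARY of the pair channel (pub-hubbard r3) for the typed R3/R4 objects of
`R3R4Props`; it certifies no number and reaches no rung.

On the `L × L` torus with `L` even let `P` be Lieb's particle–hole unitary with the staggered phases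
`(-1)^{x₁+x₂}`. The tree has `P H(t,t',U) Pᴴ = H(t,-t',U) - U N + U L²`
(`particleHole_hubbardTorusTT'`; nearest-neighbour bonds are bipartite, next-nearest ones are not)
and `P Δ_x Pᴴ = Δ_xᴴ` for local singlet pairs with real form factor vanishing at `0`
(`ParticleHole.particleHole_mul_localPair_mul_conjTranspose`). Recorded here:

* §1 two local pairs with DISJOINT BOND STARS satisfy `[Δ_x, Δ_yᴴ] = 0` (CAR), whence
  `re ⟨Pᴴψ, Δ_xᴴ Δ_y Pᴴψ⟩ = re ⟨ψ, Δ_xᴴ Δ_y ψ⟩`, and for a SITE-DISJOINT displacement `r`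
  (`r + e' - e ∉ Lℤ²` for all `e, e' ∈ {0, ±e₁, ±e₂}`; e.g. `r = (2,2)` at `L = 4`, and every `r`
  with a coordinate `rᵢ ≡ 3, …, L - 3 (mod L)`) the translation-averaged `d`-wave correlator of `R3R4Props` obeys
  `P̄_d(L, r; Pᴴψ) = P̄_d(L, r; ψ)` (`avgPairCorr_particleHole`);
* §2 THE DICTIONARY: for `L` even, hole doping at `t'` is electron doping at `-t'` in the pair
  channel — unit ground states of `hubbardTorusTT' L t (-t') U` with `N` electrons (all `S^z`, or
  `S^z = M`) go under `Pᴴ` to unit ground states of `hubbardTorusTT' L t t' U` with `2L² - N`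
  electrons (`S^z = -M`), so every statement "`P̄_d(L, r; ψ) ∈ [lo, hi]` for all such ground states"
  at `(t', N)` is EQUIVALENT to the same statement at `(-t', 2L² - N)`
  (`pairCorrWindow_sector_iff_particleHole`, `pairCorrCeiling_iff_particleHole`), and the
  certificate shapes `PairCorrWindowCert` / `FiniteDichotomyCert` transfer with the same ends
  (`pairCorrWindowCert_particleHole`, `finiteDichotomyCert_particleHole`). In particular the brief's
  dichotomy at `(U, δ) = (8, 1/8)` hole doping, `t' = 0` vs `t' = -1/4`, is the same finite-volume
  statement as the dichotomy at `1/8` ELECTRON doping, `t' = 0` vs `t' = +1/4`.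

Elementary; Lieb–Wu, Physica A 321 (2003) 1, §1 eq. (3); Scalapino, Phys. Rep. 250 (1995) 329, §2;
the observable is that of Qin et al., PRX 10 (2020) 031016, §II. [cite: LiebWuPhysicaA2003, §1 eq. (3)]
[cite: Scalapino1995, §2] [cite: QinEtAl2020, §II]
-/

noncomputable section

namespace Summit.HubbardSuperconductivity.HubbardLadder

open Matrix Literature.Probability.LatticeModels Literature.MathematicalPhysics.QuantumLattice
  HubbardWave0 Summit.HubbardSuperconductivity.HubbardSuperconductivity.Theorems
open scoped ComplexOrder ComplexConjugate

namespace PairChannelParticleHole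

/-! ## §1 Local pairs with disjoint bond stars; `P̄_d` on conjugates -/

section Torus

variable {L : ℕ} [NeZero L]

/-- Distinct torus sites carry distinct orbitals. [cite: EsslerEtAl2005, §2.1] -/
theorem orb_ofTorusSite_ne {p q : TorusSite 2 L} (h : p ≠ q) (σ τ : Fin 2) :
    orb (FermionTorus.ofTorusSite p) σ ≠ orb (FermionTorus.ofTorusSite q) τ := by
  intro h'
  apply h
  have h1 := (orb_eq_orb_iff.1 h').1
  simpa using congrArg FermionTorus.toTorusSite h1

/-- **`[Δ_x, Δ_yᴴ] = 0` for disjoint bond stars.** If no site of the star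
`{x + e : e ∈ {0} ∪ unitSteps}` coincides with a site of the star of `y`, the local pair `Δ_x` (form
factor `g`) commutes with the adjoint local pair `Δ_yᴴ` (form factor `g'`): each term is a product of
two annihilators against a product of two creators on four further modes. [cite: Scalapino1995, §2] -/
theorem commute_localPair_conjTranspose_localPair (g g' : Site 2 → ℝ) {x y : TorusSite 2 L}
    (hxy : ∀ e ∈ insert (0 : Site 2) unitSteps, ∀ e' ∈ insert (0 : Site 2) unitSteps,
      x + Torus.proj L e ≠ y + Torus.proj L e') :
    Commute (localPair g L x) (localPair g' L y)ᴴ := by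
  have h0 : Torus.proj L (0 : Site 2) = 0 := by funext i; simp
  have h0mem : (0 : Site 2) ∈ insert (0 : Site 2) unitSteps := Finset.mem_insert_self _ _
  have hxy0 : x ≠ y := by simpa [h0] using hxy 0 h0mem 0 h0mem
  have hxe : ∀ e' ∈ insert (0 : Site 2) unitSteps, x ≠ y + Torus.proj L e' := fun e' he' => by
    simpa [h0] using hxy 0 h0mem e' he'
  have hex : ∀ e ∈ insert (0 : Site 2) unitSteps, x + Torus.proj L e ≠ y := fun e he => by
    simpa [h0] using hxy e he 0 h0mem
  unfold localPair
  rw [conjTranspose_sum]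
  refine Commute.sum_left _ _ _ fun e he => Commute.sum_right _ _ _ fun e' he' => ?_
  rw [conjTranspose_smul, conjTranspose_sub, conjTranspose_mul, conjTranspose_mul,
    annihilation_conjTranspose, annihilation_conjTranspose, annihilation_conjTranspose,
    annihilation_conjTranspose]
  refine (Commute.smul_right ?_ _).smul_left _
  refine Commute.sub_left (Commute.sub_right ?_ ?_) (Commute.sub_right ?_ ?_) <;>
    exact commute_pairAnnihilation_pairCreation
      (orb_ofTorusSite_ne (hxe e' he') _ _) (orb_ofTorusSite_ne (hxy e he e' he') _ _)
      (orb_ofTorusSite_ne hxy0 _ _) (orb_ofTorusSite_ne (hex e he) _ _)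

/-- **The pair correlator on particle–hole conjugates.** For a real form factor vanishing at `0`
and local pairs `Δ_x`, `Δ_y` with disjoint bond stars on the even torus:
`⟨Pᴴψ, Δ_xᴴ Δ_y Pᴴψ⟩ = ⟨ψ, Δ_yᴴ Δ_x ψ⟩`. [cite: Scalapino1995, §2] -/
theorem expect_localPair_conjTranspose_mulVec (hL : Even L) (g : Site 2 → ℝ) (hg0 : g 0 = 0)
    {x y : TorusSite 2 L}
    (hxy : ∀ e ∈ insert (0 : Site 2) unitSteps, ∀ e' ∈ insert (0 : Site 2) unitSteps,
      x + Torus.proj L e ≠ y + Torus.proj L e')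
    (ψ : Fock (Orb (FermionTorus 2 L))) :
    expect ((localPair g L x)ᴴ * localPair g L y)
        ((particleHole (fun j : Orb (FermionTorus 2 L) => ((torusStagger (ofLex j).1 : ℤ) : ℂ)))ᴴ *ᵥ
          ψ) =
      expect ((localPair g L y)ᴴ * localPair g L x) ψ :=
  have hn : ∀ j : Orb (FermionTorus 2 L), ‖((torusStagger (ofLex j).1 : ℤ) : ℂ)‖ = 1 :=
    fun _ => norm_intCast_units _
  expect_conjTranspose_mulVec_of_conj _ hn
    (ParticleHole.particleHole_mul_localPair_mul_conjTranspose hL g hg0 x)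
    (ParticleHole.particleHole_mul_localPair_mul_conjTranspose hL g hg0 y)
    (commute_localPair_conjTranspose_localPair g g hxy) ψ

/-- Real parts: `re ⟨Pᴴψ, Δ_xᴴ Δ_y Pᴴψ⟩ = re ⟨ψ, Δ_xᴴ Δ_y ψ⟩` for disjoint bond stars
(`⟨ψ, Δ_yᴴ Δ_x ψ⟩ = conj ⟨ψ, Δ_xᴴ Δ_y ψ⟩`). [cite: Scalapino1995, §2] -/
theorem re_expect_localPair_conjTranspose_mulVec (hL : Even L) (g : Site 2 → ℝ) (hg0 : g 0 = 0)
    {x y : TorusSite 2 L}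
    (hxy : ∀ e ∈ insert (0 : Site 2) unitSteps, ∀ e' ∈ insert (0 : Site 2) unitSteps,
      x + Torus.proj L e ≠ y + Torus.proj L e')
    (ψ : Fock (Orb (FermionTorus 2 L))) :
    (expect ((localPair g L x)ᴴ * localPair g L y)
        ((particleHole (fun j : Orb (FermionTorus 2 L) => ((torusStagger (ofLex j).1 : ℤ) : ℂ)))ᴴ *ᵥ
          ψ)).re =
      (expect ((localPair g L x)ᴴ * localPair g L y) ψ).re := by
  rw [expect_localPair_conjTranspose_mulVec hL g hg0 hxy ψ,
    show (localPair g L y)ᴴ * localPair g L x = ((localPair g L x)ᴴ * localPair g L y)ᴴ by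
      rw [conjTranspose_mul, conjTranspose_conjTranspose],
    expect_conjTranspose_eq_star, Complex.star_def, Complex.conj_re]

omit [NeZero L] in
/-- A site-disjoint displacement `r` (`r + e' - e ∉ Lℤ²` for `e, e' ∈ {0, ±e₁, ±e₂}`) separates the
bond stars of `x` and `x + r`. [cite: QinEtAl2020, §II] -/
theorem starDisjoint_of_siteDisjoint {r : Site 2}
    (hr : ∀ e ∈ insert (0 : Site 2) unitSteps, ∀ e' ∈ insert (0 : Site 2) unitSteps,
      Torus.proj L (r + e' - e) ≠ 0) (x : TorusSite 2 L) :
    ∀ e ∈ insert (0 : Site 2) unitSteps, ∀ e' ∈ insert (0 : Site 2) unitSteps,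
      x + Torus.proj L e ≠ x + Torus.proj L r + Torus.proj L e' := by
  intro e he e' he' h
  apply hr e he e' he'
  have hp : Torus.proj L (r + e' - e) = Torus.proj L r + Torus.proj L e' - Torus.proj L e := by
    funext i; simp
  rw [hp]
  rw [add_assoc] at h
  have h' := add_left_cancel h
  rw [h']
  abel

/-- **`P̄_d(L, r; Pᴴψ) = P̄_d(L, r; ψ)`** for every site-disjoint displacement `r` on the even torus:
the translation-averaged `d_{x²-y²}` pair correlator of `R3R4Props` is particle–hole invariant,
term by term in `x`. [cite: Scalapino1995, §2] [cite: QinEtAl2020, §II] -/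
theorem avgPairCorr_particleHole (hL : Even L) {r : Site 2}
    (hr : ∀ e ∈ insert (0 : Site 2) unitSteps, ∀ e' ∈ insert (0 : Site 2) unitSteps,
      Torus.proj L (r + e' - e) ≠ 0)
    (ψ : Fock (Orb (FermionTorus 2 L))) :
    avgPairCorr L r
        ((particleHole (fun j : Orb (FermionTorus 2 L) => ((torusStagger (ofLex j).1 : ℤ) : ℂ)))ᴴ *ᵥ
          ψ) =
      avgPairCorr L r ψ := by
  obtain ⟨L', rfl⟩ := Nat.exists_eq_succ_of_ne_zero (NeZero.ne L)
  simp only [avgPairCorr]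
  congr 1
  refine Finset.sum_congr rfl fun x _ => ?_
  exact re_expect_localPair_conjTranspose_mulVec hL dWaveFormFactor dWaveFormFactor_zero
    (starDisjoint_of_siteDisjoint hr x) ψ

/-! ## §2 The dictionary: hole doping at `t'` ≡ electron doping at `-t'` in the pair channel -/

omit [NeZero L] in
/-- **Joint-sector ground states of the `t–t'` torus under particle–hole conjugation.** For `L`
even and `N ≤ 2L²`: if `ψ` is a unit ground state of `hubbardTorusTT' L t (-t') U` in the sector
`(N, S^z = M)`, then `Pᴴψ` is a unit ground state of `hubbardTorusTT' L t t' U` in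
`(2L² - N, S^z = -M)`. The conjugation identity is assembled from the two graph lemmas exactly as in
the tree's `groundEnergy_hubbardTorusTT'_particleHole` (same syntactic form).
[cite: LiebWuPhysicaA2003, §1 eq. (3)] [cite: EsslerEtAl2005, §2.2.4] -/
theorem isGroundStateInSector_particleHole_TT' (hL : Even L) (t t' U : ℝ) {N : ℕ}
    (hN : N ≤ 2 * L ^ 2) {M : ℝ} {ψ : Fock (Orb (FermionTorus 2 L))}
    (hψ : IsGroundStateInSector (hubbardTorusTT' L t (-t') U) N M ψ) (h1 : star ψ ⬝ᵥ ψ = 1) :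
    IsGroundStateInSector (hubbardTorusTT' L t t' U) (2 * L ^ 2 - N) (-M)
      ((particleHole (fun j : Orb (FermionTorus 2 L) => ((torusStagger (ofLex j).1 : ℤ) : ℂ)))ᴴ *ᵥ
        ψ) := by
  have hcard : Fintype.card (FermionTorus 2 L) = L ^ 2 := by simp [FermionTorus, Fintype.card_lex]
  have hn : ∀ j : Orb (FermionTorus 2 L), ‖((torusStagger (ofLex j).1 : ℤ) : ℂ)‖ = 1 :=
    fun _ => norm_intCast_units _
  have hNN := hamiltonian_particleHole_bipartite_holds (fermionTorusGraph 2 L) t U torusStagger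
    (fun x y hxy => torusStagger_eq_neg_of_adj_holds hL hxy)
  have hNNN := hamiltonian_particleHole_sameSign (fermionTorusDiagGraph L) t' 0 torusStagger
    (fun x y hxy => torusStagger_eq_of_diagAdj hL hxy)
  have key := congrArg₂ (· + ·) hNN hNNN
  simp only [zero_mul, Complex.ofReal_zero, zero_smul, sub_zero, add_zero] at key
  rw [← Matrix.add_mul, ← Matrix.mul_add, ← hubbardTorusTT', add_right_comm, sub_add_eq_add_sub,
    ← hubbardTorusTT'] at key
  have h := isGroundStateInSector_conjTranspose_mulVec_of_conj _ hn key (N := N)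
    (by rw [hcard]; exact hN) hψ h1
  rw [hcard] at h
  exact h

omit [NeZero L] in
/-- **`N`-sector ground states of the `t–t'` torus under particle–hole conjugation** (all `S^z`):
for `L` even and `N ≤ 2L²`, unit ground states of `hubbardTorusTT' L t (-t') U` among `N`-particle
vectors go under `Pᴴ` to unit ground states of `hubbardTorusTT' L t t' U` among `(2L² - N)`-particle
vectors. [cite: LiebWuPhysicaA2003, §1 eq. (3)] [cite: EsslerEtAl2005, §2.2.4] -/
theorem isGroundState_particleHole_TT' (hL : Even L) (t t' U : ℝ) {N : ℕ} (hN : N ≤ 2 * L ^ 2)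
    {ψ : Fock (Orb (FermionTorus 2 L))} (hψ : IsGroundState (hubbardTorusTT' L t (-t') U) N ψ)
    (h1 : star ψ ⬝ᵥ ψ = 1) :
    IsGroundState (hubbardTorusTT' L t t' U) (2 * L ^ 2 - N)
      ((particleHole (fun j : Orb (FermionTorus 2 L) => ((torusStagger (ofLex j).1 : ℤ) : ℂ)))ᴴ *ᵥ
        ψ) := by
  have hcard : Fintype.card (FermionTorus 2 L) = L ^ 2 := by simp [FermionTorus, Fintype.card_lex]
  have hn : ∀ j : Orb (FermionTorus 2 L), ‖((torusStagger (ofLex j).1 : ℤ) : ℂ)‖ = 1 :=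
    fun _ => norm_intCast_units _
  have hNN := hamiltonian_particleHole_bipartite_holds (fermionTorusGraph 2 L) t U torusStagger
    (fun x y hxy => torusStagger_eq_neg_of_adj_holds hL hxy)
  have hNNN := hamiltonian_particleHole_sameSign (fermionTorusDiagGraph L) t' 0 torusStagger
    (fun x y hxy => torusStagger_eq_of_diagAdj hL hxy)
  have key := congrArg₂ (· + ·) hNN hNNN
  simp only [zero_mul, Complex.ofReal_zero, zero_smul, sub_zero, add_zero] at key
  rw [← Matrix.add_mul, ← Matrix.mul_add, ← hubbardTorusTT', add_right_comm, sub_add_eq_add_sub,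
    ← hubbardTorusTT'] at key
  have h := isGroundState_conjTranspose_mulVec_of_conj _ hn key (N := N)
    (by rw [hcard]; exact hN) hψ h1
  rw [hcard] at h
  exact h

/-- **The dictionary, `S^z = 0` form.** For `L` even, `N ≤ 2L²` and a site-disjoint `r`: a window
`[lo, hi]` contains `P̄_d(L, r; ψ)` for every unit ground state `ψ` of `hubbardTorusTT' L t t' U` in
the sector `(N, S^z = 0)` iff it does so for every unit ground state of `hubbardTorusTT' L t (-t') U`
in the sector `(2L² - N, S^z = 0)`. [cite: LiebWuPhysicaA2003, §1 eq. (3)] [cite: Scalapino1995, §2] -/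
theorem pairCorrWindow_sector_iff_particleHole (hL : Even L) (t t' U : ℝ) {N : ℕ}
    (hN : N ≤ 2 * L ^ 2) {r : Site 2}
    (hr : ∀ e ∈ insert (0 : Site 2) unitSteps, ∀ e' ∈ insert (0 : Site 2) unitSteps,
      Torus.proj L (r + e' - e) ≠ 0) (lo hi : ℝ) :
    (∀ ψ : Fock (Orb (FermionTorus 2 L)), star ψ ⬝ᵥ ψ = 1 →
        IsGroundStateInSector (hubbardTorusTT' L t t' U) N 0 ψ →
          lo ≤ avgPairCorr L r ψ ∧ avgPairCorr L r ψ ≤ hi) ↔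
      (∀ φ : Fock (Orb (FermionTorus 2 L)), star φ ⬝ᵥ φ = 1 →
        IsGroundStateInSector (hubbardTorusTT' L t (-t') U) (2 * L ^ 2 - N) 0 φ →
          lo ≤ avgPairCorr L r φ ∧ avgPairCorr L r φ ≤ hi) := by
  have hn : ∀ j : Orb (FermionTorus 2 L), ‖((torusStagger (ofLex j).1 : ℤ) : ℂ)‖ = 1 :=
    fun _ => norm_intCast_units _
  constructor
  · intro h φ hφ1 hφ
    have hψ := isGroundStateInSector_particleHole_TT' hL t t' U (Nat.sub_le _ _) hφ hφ1
    rw [Nat.sub_sub_self hN, neg_zero] at hψ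
    have := h _ (by rw [ParticleHole.star_conjTranspose_mulVec_dotProduct _ hn, hφ1]) hψ
    rwa [avgPairCorr_particleHole hL hr] at this
  · intro h ψ hψ1 hψ
    have hψ' : IsGroundStateInSector (hubbardTorusTT' L t (-(-t')) U) N 0 ψ := by rwa [neg_neg]
    have hφ := isGroundStateInSector_particleHole_TT' hL t (-t') U hN hψ' hψ1
    rw [neg_zero] at hφ
    have := h _ (by rw [ParticleHole.star_conjTranspose_mulVec_dotProduct _ hn, hψ1]) hφ
    rwa [avgPairCorr_particleHole hL hr] at this

/-- **The dictionary, `N`-sector form** (all `S^z`; the form of the cell's pair-channel rows): for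
`L` even, `N ≤ 2L²`, a site-disjoint `r` and any `B`, `P̄_d(L, r; ψ) ≤ B` for every unit
`N`-particle ground state `ψ` of `hubbardTorusTT' L t t' U` iff `P̄_d(L, r; φ) ≤ B` for every unit
`(2L² - N)`-particle ground state `φ` of `hubbardTorusTT' L t (-t') U`.
[cite: LiebWuPhysicaA2003, §1 eq. (3)] [cite: Scalapino1995, §2] -/
theorem pairCorrCeiling_iff_particleHole (hL : Even L) (t t' U : ℝ) {N : ℕ} (hN : N ≤ 2 * L ^ 2)
    {r : Site 2}
    (hr : ∀ e ∈ insert (0 : Site 2) unitSteps, ∀ e' ∈ insert (0 : Site 2) unitSteps,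
      Torus.proj L (r + e' - e) ≠ 0) (B : ℝ) :
    (∀ ψ : Fock (Orb (FermionTorus 2 L)), IsGroundState (hubbardTorusTT' L t t' U) N ψ →
        star ψ ⬝ᵥ ψ = 1 → avgPairCorr L r ψ ≤ B) ↔
      (∀ φ : Fock (Orb (FermionTorus 2 L)),
        IsGroundState (hubbardTorusTT' L t (-t') U) (2 * L ^ 2 - N) φ →
          star φ ⬝ᵥ φ = 1 → avgPairCorr L r φ ≤ B) := by
  have hn : ∀ j : Orb (FermionTorus 2 L), ‖((torusStagger (ofLex j).1 : ℤ) : ℂ)‖ = 1 :=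
    fun _ => norm_intCast_units _
  constructor
  · intro h φ hφ hφ1
    have hψ := isGroundState_particleHole_TT' hL t t' U (Nat.sub_le _ _) hφ hφ1
    rw [Nat.sub_sub_self hN] at hψ
    have := h _ hψ (by rw [ParticleHole.star_conjTranspose_mulVec_dotProduct _ hn, hφ1])
    rwa [avgPairCorr_particleHole hL hr] at this
  · intro h ψ hψ hψ1
    have hψ' : IsGroundState (hubbardTorusTT' L t (-(-t')) U) N ψ := by rwa [neg_neg]
    have hφ := isGroundState_particleHole_TT' hL t (-t') U hN hψ' hψ1
    have := h _ hφ (by rw [ParticleHole.star_conjTranspose_mulVec_dotProduct _ hn, hψ1])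
    rwa [avgPairCorr_particleHole hL hr] at this

/-- **R3 windows transfer.** A certified window for `P̄_d(L, r)` over the `S^z = 0` ground states of
the family `L ↦ hubbardTorusTT' L t t' U` at electron numbers `N` IS a certified window (same ends)
for `L ↦ hubbardTorusTT' L t (-t') U` at electron numbers `L ↦ 2L² - N L`, at every even `L` with
`N L ≤ 2L²` and site-disjoint `r`. [cite: QinEtAl2020, §II] -/
def pairCorrWindowCert_particleHole (hL : Even L) {t t' U : ℝ} {N : ℕ → ℕ} (hN : N L ≤ 2 * L ^ 2)
    {r : Site 2}
    (hr : ∀ e ∈ insert (0 : Site 2) unitSteps, ∀ e' ∈ insert (0 : Site 2) unitSteps,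
      Torus.proj L (r + e' - e) ≠ 0)
    (w : PairCorrWindowCert (fun L => hubbardTorusTT' L t t' U) N L r) :
    PairCorrWindowCert (fun L => hubbardTorusTT' L t (-t') U) (fun L => 2 * L ^ 2 - N L) L r where
  lo := w.lo
  hi := w.hi
  sound := (pairCorrWindow_sector_iff_particleHole hL t t' U hN hr w.lo w.hi).1 w.sound

/-- **R3 dichotomies transfer.** A finite dichotomy at `(L, r)` between the families
`hubbardTorusTT' · t t₋ U` (disordered side) and `hubbardTorusTT' · t t₊ U` (ordered side) at
electron numbers `N` IS a finite dichotomy (same `a < b`) between `hubbardTorusTT' · t (-t₋) U` and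
`hubbardTorusTT' · t (-t₊) U` at electron numbers `L ↦ 2L² - N L` (even `L`, `N L ≤ 2L²`,
site-disjoint `r`): every certified R3 instance is born with its electron-doped twin.
[cite: QinEtAl2020, §III.B] -/
def finiteDichotomyCert_particleHole (hL : Even L) {t tn tp U : ℝ} {N : ℕ → ℕ}
    (hN : N L ≤ 2 * L ^ 2) {r : Site 2}
    (hr : ∀ e ∈ insert (0 : Site 2) unitSteps, ∀ e' ∈ insert (0 : Site 2) unitSteps,
      Torus.proj L (r + e' - e) ≠ 0)
    (cert : FiniteDichotomyCert (fun L => hubbardTorusTT' L t tn U)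
      (fun L => hubbardTorusTT' L t tp U) N L r) :
    FiniteDichotomyCert (fun L => hubbardTorusTT' L t (-tn) U)
      (fun L => hubbardTorusTT' L t (-tp) U) (fun L => 2 * L ^ 2 - N L) L r where
  a := cert.a
  b := cert.b
  a_lt_b := cert.a_lt_b
  abs_le_of_neg φ hφ1 hφ := by
    have hn : ∀ j : Orb (FermionTorus 2 L), ‖((torusStagger (ofLex j).1 : ℤ) : ℂ)‖ = 1 :=
      fun _ => norm_intCast_units _
    have hψ := isGroundStateInSector_particleHole_TT' hL t tn U (Nat.sub_le _ _) hφ hφ1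
    rw [Nat.sub_sub_self hN, neg_zero] at hψ
    have := cert.abs_le_of_neg _
      (by rw [ParticleHole.star_conjTranspose_mulVec_dotProduct _ hn, hφ1]) hψ
    rwa [avgPairCorr_particleHole hL hr] at this
  le_of_pos φ hφ1 hφ := by
    have hn : ∀ j : Orb (FermionTorus 2 L), ‖((torusStagger (ofLex j).1 : ℤ) : ℂ)‖ = 1 :=
      fun _ => norm_intCast_units _
    have hψ := isGroundStateInSector_particleHole_TT' hL t tp U (Nat.sub_le _ _) hφ hφ1
    rw [Nat.sub_sub_self hN, neg_zero] at hψ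
    have := cert.le_of_pos _
      (by rw [ParticleHole.star_conjTranspose_mulVec_dotProduct _ hn, hφ1]) hψ
    rwa [avgPairCorr_particleHole hL hr] at this

end Torus

/-- `r = (2,2)` is site-disjoint on the `4 × 4` torus (the displacement of the cell's pair-channel
rows `PairCorrSectorRows*`). [cite: QinEtAl2020, §II] -/
theorem siteDisjoint_four_22 :
    ∀ e ∈ insert (0 : Site 2) unitSteps, ∀ e' ∈ insert (0 : Site 2) unitSteps,
      Torus.proj 4 (![2, 2] + e' - e) ≠ 0 := by
  decide

end PairChannelParticleHole

/-! ### Typed obligation (the cell's house style: `@[conjecture] def` + `_holds`) -/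

/-- **Typed statement (exact symmetry; NOT a ladder rung, certifies no number) — THE PARTICLE–HOLE
DICTIONARY OF THE PAIR CHANNEL.** For every even `L ≥ 1`, all `t, t', U`, every `N ≤ 2L²` and every
site-disjoint displacement `r`: (i) a window `[lo, hi]` contains `P̄_d(L, r; ψ)` for all unit ground
states `ψ` of `hubbardTorusTT' L t t' U` in the sector `(N, S^z = 0)` iff it contains `P̄_d(L, r; φ)`
for all unit ground states `φ` of `hubbardTorusTT' L t (-t') U` in the sector `(2L² - N, S^z = 0)`;
(ii) a ceiling `P̄_d(L, r; ·) ≤ B` holds on all unit `N`-particle ground states of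
`hubbardTorusTT' L t t' U` iff it holds on all unit `(2L² - N)`-particle ground states of
`hubbardTorusTT' L t (-t') U` — hole doping at `t'` is electron doping at `-t'` for the R3 observable.
PROVED (`pairChannelParticleHoleDictionary_holds`). HONEST LABEL: a statement about the finite even
torus only; nothing on R3/R4, nothing on H/H₀. [cite: LiebWuPhysicaA2003, §1 eq. (3)]
[cite: QinEtAl2020, §II] -/
@[conjecture] def PairChannelParticleHoleDictionary : Prop :=
  (∀ (L : ℕ) [NeZero L], Even L → ∀ (t t' U : ℝ) (N : ℕ), N ≤ 2 * L ^ 2 → ∀ r : Site 2,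
    (∀ e ∈ insert (0 : Site 2) unitSteps, ∀ e' ∈ insert (0 : Site 2) unitSteps,
      Torus.proj L (r + e' - e) ≠ 0) → ∀ lo hi : ℝ,
      (∀ ψ : Fock (Orb (FermionTorus 2 L)), star ψ ⬝ᵥ ψ = 1 →
          IsGroundStateInSector (hubbardTorusTT' L t t' U) N 0 ψ →
            lo ≤ avgPairCorr L r ψ ∧ avgPairCorr L r ψ ≤ hi) ↔
        (∀ φ : Fock (Orb (FermionTorus 2 L)), star φ ⬝ᵥ φ = 1 →
          IsGroundStateInSector (hubbardTorusTT' L t (-t') U) (2 * L ^ 2 - N) 0 φ →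
            lo ≤ avgPairCorr L r φ ∧ avgPairCorr L r φ ≤ hi)) ∧
  (∀ (L : ℕ) [NeZero L], Even L → ∀ (t t' U : ℝ) (N : ℕ), N ≤ 2 * L ^ 2 → ∀ r : Site 2,
    (∀ e ∈ insert (0 : Site 2) unitSteps, ∀ e' ∈ insert (0 : Site 2) unitSteps,
      Torus.proj L (r + e' - e) ≠ 0) → ∀ B : ℝ,
      (∀ ψ : Fock (Orb (FermionTorus 2 L)), IsGroundState (hubbardTorusTT' L t t' U) N ψ →
          star ψ ⬝ᵥ ψ = 1 → avgPairCorr L r ψ ≤ B) ↔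
        (∀ φ : Fock (Orb (FermionTorus 2 L)),
          IsGroundState (hubbardTorusTT' L t (-t') U) (2 * L ^ 2 - N) φ →
            star φ ⬝ᵥ φ = 1 → avgPairCorr L r φ ≤ B))

/-- **Proof of `PairChannelParticleHoleDictionary`.** -/
theorem pairChannelParticleHoleDictionary_holds : PairChannelParticleHoleDictionary :=
  ⟨fun _ _ hL t t' U _ hN _ hr lo hi =>
      PairChannelParticleHole.pairCorrWindow_sector_iff_particleHole hL t t' U hN hr lo hi,
    fun _ _ hL t t' U _ hN _ hr B =>
      PairChannelParticleHole.pairCorrCeiling_iff_particleHole hL t t' U hN hr B⟩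

end Summit.HubbardSuperconductivity.HubbardLadder

end
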